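import Literature.LinearAlgebra.Matrix.SymplecticPairComplementLift
import Literature.LinearAlgebra.Matrix.IntegerSymplecticGroupPrimitiveVectors
import Literature.LinearAlgebra.Matrix.IntegerSymplecticUpperInvolutionNormalForm
import HarnessLib

/-!
# Goresky–Tai 2017, Lemma 45: every integral symplectic involution of multiplier `−1` is
# `Sp_{2n}(ℤ)`-conjugate to `(1 S; 0 −1)`, `S` symmetric — the induction assembled, and the normal forms

Goresky–Tai, *Real structures on ordinary abelian varieties*, arXiv:1701.07742, Appendix §19.2 p0043–p0044 (verbatim):

> «**Lemma 45.** Let `𝔅₀` be the standard symplectic form on `ℤ^{2n}` and let `τ ∈ GSp_{2n}(ℤ)` be an involution with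
> multiplier equal to `−1`.  Then `τ` is `Sp_{2n}(ℤ)` conjugate to an element `(I S; 0 −I)` where `S` is a symmetric matrix
> consisting of zeroes and ones which may be taken to be one of the following: if `rank(S) = r` is odd then
> `S = I_r ⊕ 0_{n−r}`; if `r` is even then either `S = I_r ⊕ 0_{n−r}` or `S = H ⊕ H ⋯ ⊕ H ⊕ 0_{n−r}` where `H = (0 1; 1 0)`.»
> Proof: «There exists a vector `v ∈ ℤ^{2n}` that is primitive and has `τ(v) = v`. … there exists `g ∈ Sp_{2n}(ℤ)` so that
> `gv = e_1` … It follows that `τ` is `Sp_{2n}(ℤ)` conjugate to a matrix `(A B; C D)` where `A = (1 *; 0 A₁)`, …, and where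
> `(A₁ B₁; C₁ D₁) ∈ GSp_{2n−2}(ℤ)` is an involution with multiplier equal to `−1`.  By induction, the involution `τ` is
> therefore conjugate to such an element where `A₁ = I`, `B₁` is symmetric, `C₁ = 0` and `D₁ = −I`.  The condition `τ² = I`
> then implies that `A = I`, `D = −I`, `C = 0` and `B` is symmetric. … Therefore, we may take `B` to consist of zeroes and
> ones.  The problem then reduces to describing the list of possible symmetric bilinear forms on a `ℤ/(2)` vector space.»

## What is formalized (Mathlib conventions: `J = Matrix.J l ℤ = (0 −1; 1 0)`, `Sp = Matrix.symplecticGroup l ℤ`; multiplier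
## `−1` as `ᵗτJτ = −J`; `u(B) = (1 B; 0 −1)`)

This file ASSEMBLES the printed induction from the tree's pieces: the first step
(`IntegerSymplecticGroupPrimitiveVectors`: a primitive `τ`-fixed vector, Siegel's transitivity, conjugation to a `τ′`
fixing `e_1` with `(inr)`-row `−ᵗf_1`), the induction machinery (`SymplecticPairComplementLift`: restriction to the
complement of the pair, lifts `Sp_{2n−2} ↪ Sp_{2n}`, shape transport, «`τ² = I` then implies `A = I`, `D = −I`, `C = 0`»)
and the normal forms of `B` (`IntegerSymplecticUpperInvolutionNormalForm`, Albert over `𝔽₂`):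

* §1 `transport` (private) — invariance of the statement under a reindexing `l ≃ l′` (`J`, `Sp`, `u(B)` pull back);
* §2 ★ `submatrix_involution_multiplier_neg_one` («`(A₁ B₁; C₁ D₁) ∈ GSp_{2n−2}(ℤ)` is an involution with multiplier
  equal to `−1`»), ★ `step` (the induction step on `Option m ⊕ Option m` from the statement on `m ⊕ m`);
* §3 ★★ `exists_symplectic_conj_eq_upperInvolution` — LEMMA 45, first sentence: for any finite `l` and
  `τ ∈ M_{2n}(ℤ)` with `τ² = 1`, `ᵗτJτ = −J` there are `g, g′ ∈ Sp_{2n}(ℤ)`, `g′g = 1`, and a SYMMETRIC `B` with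
  `g′τg = (1 B; 0 −1)` (induction on `n` over `Fin n`, `Fin (n+1) ≃ Option (Fin n)`, then transport to `l`);
  ★★ `exists_symplectic_conj_eq_normalForm` — LEMMA 45 with the normal forms: `g′τg = u(S₀)` with `S₀ = I_λ ⊕ 0_μ`
  (re-indexed; when `B` has an odd diagonal entry) or `S₀ = (0 I_k; I_k 0) ⊕ 0_μ` (`= H^{⊕k} ⊕ 0` up to the order of
  the coordinates; when the diagonal of `B` is even).

Scope: GT's parity remark («if `rank(S) = r` is odd then `S = I_r ⊕ 0`») is implicit (the hyperbolic case has even rank);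
the two cases are distinguished here by the parity of the diagonal of `B`, as in Albert's theorem, not by an intrinsic
invariant of `τ`.  THEOREMS ONLY; no definition, instance, notation or named fact.

## References

* [GoreskyTai2017RealStructuresOrdinary] M. Goresky, Y.-S. Tai, *Real structures on ordinary abelian varieties*,
  arXiv:1701.07742 (2017), Appendix §19.2, Lemma 45 and its proof.
* [Albert1938] A. A. Albert, Trans. AMS 43 (1938) — the `𝔽₂` classification (tree `AlbertSymmetricFormsCharTwo`).
-/

noncomputable section

open Matrix

namespace Literature.LinearAlgebra.Matrix

namespace IntegerSymplecticInvolution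

open SymplecticPairComplement IntegerSymplecticPrimitive

/-! ## §1 Transport along a reindexing `l ≃ l′` -/

/-- `(-X)|_{r,c} = -(X|_{r,c})`. [folklore] -/
private theorem neg_submatrix {m' n' l₁ o₁ : Type*} (X : Matrix m' n' ℤ) (r : l₁ → m') (c : o₁ → n') :
    (-X).submatrix r c = -X.submatrix r c := rfl

section Reindex

variable {l l' : Type*} [Fintype l] [DecidableEq l] [Fintype l'] [DecidableEq l']

omit [Fintype l] [Fintype l'] in
/-- `J` is reindexing-invariant: `J_{l′}` pulled back along `e ⊕ e` is `J_l`. [folklore] -/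
private theorem submatrix_J_sumCongr (e : l ≃ l') :
    (Matrix.J l' ℤ).submatrix (Equiv.sumCongr e e) (Equiv.sumCongr e e) = Matrix.J l ℤ := by
  ext x y
  rcases x with i | i <;> rcases y with j | j <;>
    simp [Matrix.J, fromBlocks_apply₁₁, fromBlocks_apply₁₂, fromBlocks_apply₂₁, fromBlocks_apply₂₂, Matrix.one_apply,
      e.injective.eq_iff]

omit [Fintype l] [Fintype l'] in
/-- `u(B′)` pulled back along `e ⊕ e` is `u(B′|_e)`. [folklore] -/
private theorem submatrix_upperInvolution_sumCongr (e : l ≃ l') (B' : Matrix l' l' ℤ) :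
    (fromBlocks (1 : Matrix l' l' ℤ) B' 0 (-1 : Matrix l' l' ℤ)).submatrix (Equiv.sumCongr e e) (Equiv.sumCongr e e) =
      fromBlocks (1 : Matrix l l ℤ) (B'.submatrix e e) 0 (-1 : Matrix l l ℤ) := by
  ext x y
  rcases x with i | i <;> rcases y with j | j <;>
    simp [fromBlocks_apply₁₁, fromBlocks_apply₁₂, fromBlocks_apply₂₁, fromBlocks_apply₂₂, Matrix.one_apply,
      e.injective.eq_iff]

/-- Symplectic matrices pull back to symplectic matrices along `e ⊕ e`. [folklore] -/
private theorem submatrix_mem_symplecticGroup (e : l ≃ l') {g : Matrix (l' ⊕ l') (l' ⊕ l') ℤ} (hg : g ∈ Matrix.symplecticGroup l' ℤ) :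
    g.submatrix (Equiv.sumCongr e e) (Equiv.sumCongr e e) ∈ Matrix.symplecticGroup l ℤ := by
  rw [SymplecticGroup.mem_iff'] at hg ⊢
  rw [← submatrix_J_sumCongr e, transpose_submatrix, submatrix_mul_equiv, submatrix_mul_equiv, hg]

/-- **Transport of the normal-form statement along a reindexing**: if every integral involution of multiplier `−1` on
`l′ ⊕ l′` is `Sp`-conjugate to some `u(B′)`, the same holds on `l ⊕ l` for `l ≃ l′`. [folklore] -/
private theorem transport (e : l ≃ l')
    (P : ∀ τ' : Matrix (l' ⊕ l') (l' ⊕ l') ℤ, τ' * τ' = 1 → τ'ᵀ * Matrix.J l' ℤ * τ' = -Matrix.J l' ℤ →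
      ∃ g g' : Matrix (l' ⊕ l') (l' ⊕ l') ℤ, ∃ B : Matrix l' l' ℤ, g ∈ Matrix.symplecticGroup l' ℤ ∧
        g' ∈ Matrix.symplecticGroup l' ℤ ∧ g' * g = 1 ∧ g' * τ' * g = fromBlocks (1 : Matrix l' l' ℤ) B 0 (-1 : Matrix l' l' ℤ))
    (τ : Matrix (l ⊕ l) (l ⊕ l) ℤ) (hττ : τ * τ = 1) (hJ : τᵀ * Matrix.J l ℤ * τ = -Matrix.J l ℤ) :
    ∃ g g' : Matrix (l ⊕ l) (l ⊕ l) ℤ, ∃ B : Matrix l l ℤ, g ∈ Matrix.symplecticGroup l ℤ ∧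
      g' ∈ Matrix.symplecticGroup l ℤ ∧ g' * g = 1 ∧ g' * τ * g = fromBlocks (1 : Matrix l l ℤ) B 0 (-1 : Matrix l l ℤ) := by
  set σ : l ⊕ l ≃ l' ⊕ l' := Equiv.sumCongr e e with hσ
  set τ' : Matrix (l' ⊕ l') (l' ⊕ l') ℤ := τ.submatrix σ.symm σ.symm with hτ'
  have hback : ∀ X : Matrix (l ⊕ l) (l ⊕ l) ℤ, (X.submatrix σ.symm σ.symm).submatrix σ σ = X := fun X => by
    rw [submatrix_submatrix, Equiv.symm_comp_self, submatrix_id_id]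
  have hJ' : (Matrix.J l ℤ).submatrix σ.symm σ.symm = Matrix.J l' ℤ := by
    rw [← submatrix_J_sumCongr e, submatrix_submatrix, Equiv.self_comp_symm, submatrix_id_id]
  have hττ' : τ' * τ' = 1 := by
    rw [hτ', submatrix_mul_equiv, hττ, submatrix_one_equiv]
  have hJτ' : τ'ᵀ * Matrix.J l' ℤ * τ' = -Matrix.J l' ℤ := by
    rw [hτ', transpose_submatrix, ← hJ', submatrix_mul_equiv, submatrix_mul_equiv, hJ, neg_submatrix]
  obtain ⟨g, g', B, hg, hg', hg'g, hconj⟩ := P τ' hττ' hJτ'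
  refine ⟨g.submatrix σ σ, g'.submatrix σ σ, B.submatrix e e, submatrix_mem_symplecticGroup e hg,
    submatrix_mem_symplecticGroup e hg', ?_, ?_⟩
  · rw [submatrix_mul_equiv, hg'g, submatrix_one_equiv]
  · have h := congrArg (fun X : Matrix (l' ⊕ l') (l' ⊕ l') ℤ => X.submatrix σ σ) hconj
    rw [← submatrix_mul_equiv (e₂ := σ), ← submatrix_mul_equiv (e₂ := σ), hτ', hback,
      submatrix_upperInvolution_sumCongr] at h
    exact h

end Reindex

/-! ## §2 The induction step on `Option m ⊕ Option m` -/

section Step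

variable {m : Type*} [Fintype m] [DecidableEq m]

omit [Fintype m] in
/-- `1|_E = 1`. [folklore] -/
private theorem submatrix_one_optionPair' :
    (1 : Matrix (Option m ⊕ Option m) (Option m ⊕ Option m) ℤ).submatrix (Sum.map Option.some Option.some : m ⊕ m → Option m ⊕ Option m) (Sum.map Option.some Option.some : m ⊕ m → Option m ⊕ Option m) = 1 := by
  ext a b
  rw [submatrix_apply, Matrix.one_apply, Matrix.one_apply]
  exact if_congr (Sum.map_injective.2 ⟨Option.some_injective m, Option.some_injective m⟩).eq_iff rfl rfl

omit [DecidableEq m] in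
/-- Restriction of a product whose rank-one corrections through the pair vanish. [folklore] -/
private theorem submatrix_mul_of_vanish (M N : Matrix (Option m ⊕ Option m) (Option m ⊕ Option m) ℤ)
    (h1 : ∀ a b : m ⊕ m, M ((Sum.map Option.some Option.some : m ⊕ m → Option m ⊕ Option m) a) (Sum.inl none) * N (Sum.inl none) ((Sum.map Option.some Option.some : m ⊕ m → Option m ⊕ Option m) b) = 0)
    (h2 : ∀ a b : m ⊕ m, M ((Sum.map Option.some Option.some : m ⊕ m → Option m ⊕ Option m) a) (Sum.inr none) * N (Sum.inr none) ((Sum.map Option.some Option.some : m ⊕ m → Option m ⊕ Option m) b) = 0) :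
    (M * N).submatrix (Sum.map Option.some Option.some : m ⊕ m → Option m ⊕ Option m) (Sum.map Option.some Option.some : m ⊕ m → Option m ⊕ Option m) = M.submatrix (Sum.map Option.some Option.some : m ⊕ m → Option m ⊕ Option m) (Sum.map Option.some Option.some : m ⊕ m → Option m ⊕ Option m) * N.submatrix (Sum.map Option.some Option.some : m ⊕ m → Option m ⊕ Option m) (Sum.map Option.some Option.some : m ⊕ m → Option m ⊕ Option m) := by
  rw [submatrix_mul_optionPair]
  ext a b
  simp only [Matrix.add_apply, vecMulVec_apply, h1, h2, add_zero]

omit [Fintype m] in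
/-- Column `inl none` of `J` is column `inr none` of `1`. [folklore] -/
private theorem J_apply_inl_none' (x : Option m ⊕ Option m) :
    Matrix.J (Option m) ℤ x (Sum.inl none) =
      (1 : Matrix (Option m ⊕ Option m) (Option m ⊕ Option m) ℤ) x (Sum.inr none) := by
  rcases x with i | i <;> simp [Matrix.J, fromBlocks_apply₁₁, fromBlocks_apply₂₁, Matrix.one_apply]

omit [Fintype m] in
/-- The pair rows of `J` vanish on the complement. [folklore] -/
private theorem J_inl_none_map (b : m ⊕ m) : Matrix.J (Option m) ℤ (Sum.inl none) ((Sum.map Option.some Option.some : m ⊕ m → Option m ⊕ Option m) b) = 0 := by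
  rcases b with j | j <;> simp [Matrix.J, fromBlocks_apply₁₁, fromBlocks_apply₁₂]

omit [Fintype m] in
/-- Row `inr none` of `J` vanishes on the complement. [folklore] -/
private theorem J_inr_none_map (b : m ⊕ m) : Matrix.J (Option m) ℤ (Sum.inr none) ((Sum.map Option.some Option.some : m ⊕ m → Option m ⊕ Option m) b) = 0 := by
  rcases b with j | j <;> simp [Matrix.J, fromBlocks_apply₂₁, fromBlocks_apply₂₂]

/-- **«`(A₁ B₁; C₁ D₁) ∈ GSp_{2n−2}(ℤ)` is an involution with multiplier equal to `−1`»**: for `τ` with `τ² = 1`,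
`ᵗτJτ = −J`, `τe_1 = e_1` and `(inr none)`-row `−ᵗf_1`, the restriction `τ|_E` to the complement of the pair is again an
involution of multiplier `−1`. [cite: GoreskyTai2017RealStructuresOrdinary, App. §19.2 proof of Lemma 45] -/
theorem submatrix_involution_multiplier_neg_one {τ : Matrix (Option m ⊕ Option m) (Option m ⊕ Option m) ℤ}
    (hττ : τ * τ = 1) (hJ : τᵀ * Matrix.J (Option m) ℤ * τ = -Matrix.J (Option m) ℤ)
    (hc : ∀ x, τ x (Sum.inl none) = (1 : Matrix (Option m ⊕ Option m) (Option m ⊕ Option m) ℤ) x (Sum.inl none))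
    (hr : ∀ y, τ (Sum.inr none) y = -(1 : Matrix (Option m ⊕ Option m) (Option m ⊕ Option m) ℤ) (Sum.inr none) y) :
    τ.submatrix (Sum.map Option.some Option.some : m ⊕ m → Option m ⊕ Option m) (Sum.map Option.some Option.some : m ⊕ m → Option m ⊕ Option m) * τ.submatrix (Sum.map Option.some Option.some : m ⊕ m → Option m ⊕ Option m) (Sum.map Option.some Option.some : m ⊕ m → Option m ⊕ Option m) = 1 ∧
      (τ.submatrix (Sum.map Option.some Option.some : m ⊕ m → Option m ⊕ Option m) (Sum.map Option.some Option.some : m ⊕ m → Option m ⊕ Option m))ᵀ * Matrix.J m ℤ * τ.submatrix (Sum.map Option.some Option.some : m ⊕ m → Option m ⊕ Option m) (Sum.map Option.some Option.some : m ⊕ m → Option m ⊕ Option m) = -Matrix.J m ℤ := by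
  have hc0 : ∀ a : m ⊕ m, τ ((Sum.map Option.some Option.some : m ⊕ m → Option m ⊕ Option m) a) (Sum.inl none) = 0 := fun a => by
    rw [hc, Matrix.one_apply_ne]
    rcases a with i | i <;> simp
  have hr0 : ∀ b : m ⊕ m, τ (Sum.inr none) ((Sum.map Option.some Option.some : m ⊕ m → Option m ⊕ Option m) b) = 0 := fun b => by
    rw [hr, Matrix.one_apply_ne, neg_zero]
    rcases b with j | j <;> simp
  constructor
  · rw [← submatrix_mul_of_vanish τ τ (fun a b => by rw [hc0, zero_mul]) (fun a b => by rw [hr0, mul_zero]), hττ,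
      submatrix_one_optionPair']
  · -- `(ᵗτ J)(E a)(inl none) = τ (inr none) (E a) = 0`
    have hcol : ∀ a : m ⊕ m, (τᵀ * Matrix.J (Option m) ℤ) ((Sum.map Option.some Option.some : m ⊕ m → Option m ⊕ Option m) a) (Sum.inl none) = 0 := fun a => by
      simp only [mul_apply, J_apply_inl_none']
      rw [← mul_apply, Matrix.mul_one, transpose_apply, hr0]
    have h1 : (τᵀ * Matrix.J (Option m) ℤ * τ).submatrix (Sum.map Option.some Option.some : m ⊕ m → Option m ⊕ Option m) (Sum.map Option.some Option.some : m ⊕ m → Option m ⊕ Option m) =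
        (τᵀ * Matrix.J (Option m) ℤ).submatrix (Sum.map Option.some Option.some : m ⊕ m → Option m ⊕ Option m) (Sum.map Option.some Option.some : m ⊕ m → Option m ⊕ Option m) * τ.submatrix (Sum.map Option.some Option.some : m ⊕ m → Option m ⊕ Option m) (Sum.map Option.some Option.some : m ⊕ m → Option m ⊕ Option m) :=
      submatrix_mul_of_vanish _ _ (fun a b => by rw [hcol, zero_mul]) (fun a b => by rw [hr0, mul_zero])
    have h2 : (τᵀ * Matrix.J (Option m) ℤ).submatrix (Sum.map Option.some Option.some : m ⊕ m → Option m ⊕ Option m) (Sum.map Option.some Option.some : m ⊕ m → Option m ⊕ Option m) = (τ.submatrix (Sum.map Option.some Option.some : m ⊕ m → Option m ⊕ Option m) (Sum.map Option.some Option.some : m ⊕ m → Option m ⊕ Option m))ᵀ * Matrix.J m ℤ := by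
      rw [submatrix_mul_of_vanish _ _ (fun a b => by rw [J_inl_none_map, mul_zero])
        (fun a b => by rw [J_inr_none_map, mul_zero]), transpose_submatrix, submatrix_J_optionPair]
    rw [← h2, ← h1, hJ, neg_submatrix, submatrix_J_optionPair]

/-- **The induction step**: if every integral involution of multiplier `−1` on `m ⊕ m` is `Sp_{2n−2}(ℤ)`-conjugate to some
`u(B₁)`, then every integral involution of multiplier `−1` on `Option m ⊕ Option m` is `Sp_{2n}(ℤ)`-conjugate to some `u(B)`
(first `IntegerSymplecticPrimitive.exists_symplectic_conj_mulVec_single_eq_self`, then the restriction, the hypothesis, the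
lift, and `eq_upperInvolution_of_pair_shape`). [cite: GoreskyTai2017RealStructuresOrdinary, App. §19.2 proof of Lemma 45 («By induction …»)] -/
theorem step
    (IH : ∀ τ₁ : Matrix (m ⊕ m) (m ⊕ m) ℤ, τ₁ * τ₁ = 1 → τ₁ᵀ * Matrix.J m ℤ * τ₁ = -Matrix.J m ℤ →
      ∃ h h' : Matrix (m ⊕ m) (m ⊕ m) ℤ, ∃ B₁ : Matrix m m ℤ, h ∈ Matrix.symplecticGroup m ℤ ∧
        h' ∈ Matrix.symplecticGroup m ℤ ∧ h' * h = 1 ∧ h' * τ₁ * h = fromBlocks (1 : Matrix m m ℤ) B₁ 0 (-1 : Matrix m m ℤ))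
    (τ : Matrix (Option m ⊕ Option m) (Option m ⊕ Option m) ℤ) (hττ : τ * τ = 1)
    (hJ : τᵀ * Matrix.J (Option m) ℤ * τ = -Matrix.J (Option m) ℤ) :
    ∃ g g' : Matrix (Option m ⊕ Option m) (Option m ⊕ Option m) ℤ, ∃ B : Matrix (Option m) (Option m) ℤ,
      g ∈ Matrix.symplecticGroup (Option m) ℤ ∧ g' ∈ Matrix.symplecticGroup (Option m) ℤ ∧ g' * g = 1 ∧
      g' * τ * g = fromBlocks (1 : Matrix (Option m) (Option m) ℤ) B 0 (-1 : Matrix (Option m) (Option m) ℤ) := by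
  -- first reduction step: `τ' = g₀' τ g₀` fixes `e_1` and has `(inr none)`-row `-ᵗf_1`
  obtain ⟨g₀, g₀', hg₀, hg₀', hg₀'g₀, hfix, hrow, hsq, hmult⟩ :=
    exists_symplectic_conj_mulVec_single_eq_self hττ hJ (none : Option m)
  set τ' := g₀' * τ * g₀ with hτ'
  have hc : ∀ x, τ' x (Sum.inl none) = (1 : Matrix (Option m ⊕ Option m) (Option m ⊕ Option m) ℤ) x (Sum.inl none) := by
    intro x
    have h := congr_fun hfix x
    rw [mulVec_single_one, Matrix.col_apply] at h
    rw [h]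
    rcases x with (_ | i) | (_ | i) <;> simp
  have hr : ∀ y, τ' (Sum.inr none) y = -(1 : Matrix (Option m ⊕ Option m) (Option m ⊕ Option m) ℤ) (Sum.inr none) y := by
    intro y
    rw [hrow]
    rcases y with (_ | j) | (_ | j) <;> simp
  -- the restriction is an involution of multiplier `-1`; apply the hypothesis
  obtain ⟨hττ₁, hJ₁⟩ := submatrix_involution_multiplier_neg_one hsq hmult hc hr
  obtain ⟨h, h', B₁, hh, hh', hh'h, hconj₁⟩ := IH _ hττ₁ hJ₁
  -- lift `h`, `h'`
  obtain ⟨H, hHE, hH1, hH2, hH3, hH4⟩ := exists_lift (R := ℤ) h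
  obtain ⟨H', hH'E, hH'1, hH'2, hH'3, hH'4⟩ := exists_lift (R := ℤ) h'
  have hH : H ∈ Matrix.symplecticGroup (Option m) ℤ := mem_symplecticGroup_of_pair (hHE ▸ hh) hH1 hH2 hH3 hH4
  have hH' : H' ∈ Matrix.symplecticGroup (Option m) ℤ := mem_symplecticGroup_of_pair (hH'E ▸ hh') hH'1 hH'2 hH'3 hH'4
  have hH'H : H' * H = 1 := mul_eq_one_of_pair (by rw [hHE, hH'E, hh'h]) hH1 hH2 hH3 hH4 hH'1 hH'2 hH'3 hH'4
  have hHH' : H * H' = 1 := mul_eq_one_comm.1 hH'H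
  -- `τ'' = H' τ' H`
  set τ'' := H' * τ' * H with hτ''
  have hE'' : τ''.submatrix (Sum.map Option.some Option.some : m ⊕ m → Option m ⊕ Option m) (Sum.map Option.some Option.some : m ⊕ m → Option m ⊕ Option m) = fromBlocks (1 : Matrix m m ℤ) B₁ 0 (-1 : Matrix m m ℤ) := by
    rw [hτ'', submatrix_conj_of_pair hH1 hH3 hH'2 hH'4, hHE, hH'E, hconj₁]
  obtain ⟨hc'', hr''⟩ := pair_shape_conj (H := H) (H' := H') hc hr hH2 hH3 hH'2 hH'3
  have hsq'' : τ'' * τ'' = 1 := by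
    calc τ'' * τ'' = H' * τ' * (H * H') * τ' * H := by simp only [hτ'', Matrix.mul_assoc]
      _ = 1 := by rw [hHH', Matrix.mul_one, Matrix.mul_assoc H', hsq, Matrix.mul_one, hH'H]
  have hfinal := eq_upperInvolution_of_pair_shape (R := ℤ) two_ne_zero hsq'' hc'' hr'' hE''
  refine ⟨g₀ * H, H' * g₀', Matrix.of fun i j => τ'' (Sum.inl i) (Sum.inr j), Submonoid.mul_mem _ hg₀ hH,
    Submonoid.mul_mem _ hH' hg₀', ?_, ?_⟩
  · calc H' * g₀' * (g₀ * H) = H' * (g₀' * g₀) * H := by simp only [Matrix.mul_assoc]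
      _ = 1 := by rw [hg₀'g₀, Matrix.mul_one, hH'H]
  · calc H' * g₀' * τ * (g₀ * H) = H' * (g₀' * τ * g₀) * H := by simp only [Matrix.mul_assoc]
      _ = _ := by rw [← hτ', ← hτ'']; exact hfinal

end Step

/-- A right inverse of a symplectic matrix is symplectic (`g′ = −JᵗgJ`). [folklore] -/
private theorem mem_symplecticGroup_of_mul_eq_one {l : Type*} [Fintype l] [DecidableEq l] {g g' : Matrix (l ⊕ l) (l ⊕ l) ℤ}
    (hg : g ∈ Matrix.symplecticGroup l ℤ) (h : g * g' = 1) : g' ∈ Matrix.symplecticGroup l ℤ := by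
  have e : g' = -(Matrix.J l ℤ * gᵀ * Matrix.J l ℤ) := by
    calc g' = -(Matrix.J l ℤ * gᵀ * Matrix.J l ℤ * g) * g' := by rw [SymplecticGroup.inv_left_mul_aux hg, Matrix.one_mul]
      _ = -(Matrix.J l ℤ * gᵀ * Matrix.J l ℤ) * (g * g') := by simp only [Matrix.neg_mul, Matrix.mul_assoc]
      _ = -(Matrix.J l ℤ * gᵀ * Matrix.J l ℤ) := by rw [h, Matrix.mul_one]
  rw [e]
  exact SymplecticGroup.neg_mem (Submonoid.mul_mem _ (Submonoid.mul_mem _ (SymplecticGroup.J_mem l ℤ)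
    (SymplecticGroup.transpose_mem hg)) (SymplecticGroup.J_mem l ℤ))

/-! ## §3 Lemma 45: every integral symplectic involution of multiplier `−1` is `Sp_{2n}(ℤ)`-conjugate to `u(B)`, `B` symmetric -/

/-- The statement on `Fin n ⊕ Fin n`, by induction on `n`. [cite: GoreskyTai2017RealStructuresOrdinary, App. §19.2 proof of Lemma 45] -/
private theorem main_fin : ∀ (n : ℕ) (τ : Matrix (Fin n ⊕ Fin n) (Fin n ⊕ Fin n) ℤ), τ * τ = 1 →
    τᵀ * Matrix.J (Fin n) ℤ * τ = -Matrix.J (Fin n) ℤ →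
    ∃ g g' : Matrix (Fin n ⊕ Fin n) (Fin n ⊕ Fin n) ℤ, ∃ B : Matrix (Fin n) (Fin n) ℤ,
      g ∈ Matrix.symplecticGroup (Fin n) ℤ ∧ g' ∈ Matrix.symplecticGroup (Fin n) ℤ ∧ g' * g = 1 ∧
      g' * τ * g = fromBlocks (1 : Matrix (Fin n) (Fin n) ℤ) B 0 (-1 : Matrix (Fin n) (Fin n) ℤ) := by
  intro n
  induction n with
  | zero =>
    intro τ _ _
    refine ⟨1, 1, 0, Submonoid.one_mem _, Submonoid.one_mem _, Matrix.mul_one 1, ?_⟩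
    ext x
    exact isEmptyElim x
  | succ n ih =>
    intro τ hττ hJ
    exact transport (finSuccEquiv n) (fun τ' h1 h2 => step ih τ' h1 h2) τ hττ hJ

variable {l : Type*} [Fintype l] [DecidableEq l]

/-- **Goresky–Tai 2017, Lemma 45 (conjugacy to the upper form).**  «Let `𝔅₀` be the standard symplectic form on `ℤ^{2n}`
and let `τ ∈ GSp_{2n}(ℤ)` be an involution with multiplier equal to `−1`.  Then `τ` is `Sp_{2n}(ℤ)` conjugate to an element
`(I S; 0 −I)` where `S` is a symmetric matrix» — here: `τ² = 1`, `ᵗτJτ = −J` ⟹ `g′τg = (1 B; 0 −1)` with `g, g′ ∈ Sp_{2n}(ℤ)`,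
`g′g = 1`, `B` symmetric (Mathlib's `J = (0 −1; 1 0)`; any finite index type `l`).  The `0/1` normal forms of `S` are then
the tree's `exists_symplectic_conj_upperInvolution_zero_one` / `_one_zero` / `_hyperbolic`.
[cite: GoreskyTai2017RealStructuresOrdinary, App. §19.2 Lemma 45] -/
theorem exists_symplectic_conj_eq_upperInvolution (τ : Matrix (l ⊕ l) (l ⊕ l) ℤ) (hττ : τ * τ = 1)
    (hJ : τᵀ * Matrix.J l ℤ * τ = -Matrix.J l ℤ) :
    ∃ g g' : Matrix (l ⊕ l) (l ⊕ l) ℤ, ∃ B : Matrix l l ℤ, g ∈ Matrix.symplecticGroup l ℤ ∧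
      g' ∈ Matrix.symplecticGroup l ℤ ∧ g' * g = 1 ∧ Bᵀ = B ∧
      g' * τ * g = fromBlocks (1 : Matrix l l ℤ) B 0 (-1 : Matrix l l ℤ) := by
  obtain ⟨g, g', B, hg, hg', hg'g, hconj⟩ :=
    transport (Fintype.equivFin l) (fun τ' h1 h2 => main_fin _ τ' h1 h2) τ hττ hJ
  refine ⟨g, g', B, hg, hg', hg'g, ?_, hconj⟩
  -- symmetry of `B` from the multiplier of `g' τ g`
  have hg't : g'ᵀ * Matrix.J l ℤ * g' = Matrix.J l ℤ := SymplecticGroup.mem_iff'.1 hg'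
  have hgt : gᵀ * Matrix.J l ℤ * g = Matrix.J l ℤ := SymplecticGroup.mem_iff'.1 hg
  have hmult : (g' * τ * g)ᵀ * Matrix.J l ℤ * (g' * τ * g) = -Matrix.J l ℤ := by
    rw [transpose_mul, transpose_mul]
    calc gᵀ * (τᵀ * g'ᵀ) * Matrix.J l ℤ * (g' * τ * g) = gᵀ * (τᵀ * (g'ᵀ * Matrix.J l ℤ * g') * τ) * g := by
          simp only [Matrix.mul_assoc]
      _ = -Matrix.J l ℤ := by rw [hg't, hJ, Matrix.mul_neg, Matrix.neg_mul, hgt]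
  rw [hconj] at hmult
  exact (transpose_upperInvolution_mul_J_mul_eq_neg_J_iff B).1 hmult

/-- **Goresky–Tai 2017, Lemma 45 (the normal forms).**  An integral symplectic involution of multiplier `−1` is
`Sp_{2n}(ℤ)`-conjugate to `u(S₀) = (1 S₀; 0 −1)` with `S₀` one of Albert's `𝔽₂` normal forms: «if `rank(S) = r` is odd
then `S = I_r ⊕ 0_{n−r}`; if `r` is even then either `S = I_r ⊕ 0_{n−r}` or `S = H ⊕ ⋯ ⊕ H ⊕ 0_{n−r}`» — here:
`S₀ = (I_λ ⊕ 0_μ)` (re-indexed) when the symmetric `B` of `exists_symplectic_conj_eq_upperInvolution` has an odd diagonal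
entry, `S₀ = ((0 I_k; I_k 0) ⊕ 0_μ)` (`= H^{⊕k} ⊕ 0` up to order) when its diagonal is even.
[cite: GoreskyTai2017RealStructuresOrdinary, App. §19.2 Lemma 45] -/
theorem exists_symplectic_conj_eq_normalForm [LinearOrder l] (τ : Matrix (l ⊕ l) (l ⊕ l) ℤ) (hττ : τ * τ = 1)
    (hJ : τᵀ * Matrix.J l ℤ * τ = -Matrix.J l ℤ) :
    ∃ G G' : Matrix (l ⊕ l) (l ⊕ l) ℤ, G ∈ Matrix.symplecticGroup l ℤ ∧ G' ∈ Matrix.symplecticGroup l ℤ ∧ G' * G = 1 ∧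
      ((∃ (lam μ : ℕ) (e : l ≃ Fin lam ⊕ Fin μ), G' * τ * G =
          fromBlocks (1 : Matrix l l ℤ) ((fromBlocks 1 0 0 0 : Matrix (Fin lam ⊕ Fin μ) (Fin lam ⊕ Fin μ) ℤ).submatrix e e)
            0 (-1 : Matrix l l ℤ)) ∨
       (∃ (k μ : ℕ) (e : l ≃ (Fin k ⊕ Fin k) ⊕ Fin μ), G' * τ * G =
          fromBlocks (1 : Matrix l l ℤ) ((fromBlocks (fromBlocks 0 1 1 0) 0 0 0 :
            Matrix ((Fin k ⊕ Fin k) ⊕ Fin μ) ((Fin k ⊕ Fin k) ⊕ Fin μ) ℤ).submatrix e e) 0 (-1 : Matrix l l ℤ))) := by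
  obtain ⟨g, g', B, hg, hg', hg'g, hB, hconj⟩ := exists_symplectic_conj_eq_upperInvolution τ hττ hJ
  by_cases hd : ∃ i, ¬ (2 : ℤ) ∣ B i i
  · obtain ⟨lam, μ, e, g₂, g₂', hg₂, hg₂g₂', hconj₂⟩ := exists_symplectic_conj_upperInvolution_one_zero B hB hd
    have hg₂' : g₂' ∈ Matrix.symplecticGroup l ℤ := mem_symplecticGroup_of_mul_eq_one hg₂ hg₂g₂'
    refine ⟨g * g₂', g₂ * g', Submonoid.mul_mem _ hg hg₂', Submonoid.mul_mem _ hg₂ hg', ?_, Or.inl ⟨lam, μ, e, ?_⟩⟩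
    · calc g₂ * g' * (g * g₂') = g₂ * (g' * g) * g₂' := by simp only [Matrix.mul_assoc]
        _ = 1 := by rw [hg'g, Matrix.mul_one, hg₂g₂']
    · calc g₂ * g' * τ * (g * g₂') = g₂ * (g' * τ * g) * g₂' := by simp only [Matrix.mul_assoc]
        _ = _ := by rw [hconj, hconj₂]
  · simp only [not_exists, not_not] at hd
    obtain ⟨k, μ, e, g₂, g₂', hg₂, hg₂g₂', hconj₂⟩ := exists_symplectic_conj_upperInvolution_hyperbolic B hB hd
    have hg₂' : g₂' ∈ Matrix.symplecticGroup l ℤ := mem_symplecticGroup_of_mul_eq_one hg₂ hg₂g₂'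
    refine ⟨g * g₂', g₂ * g', Submonoid.mul_mem _ hg hg₂', Submonoid.mul_mem _ hg₂ hg', ?_, Or.inr ⟨k, μ, e, ?_⟩⟩
    · calc g₂ * g' * (g * g₂') = g₂ * (g' * g) * g₂' := by simp only [Matrix.mul_assoc]
        _ = 1 := by rw [hg'g, Matrix.mul_one, hg₂g₂']
    · calc g₂ * g' * τ * (g * g₂') = g₂ * (g' * τ * g) * g₂' := by simp only [Matrix.mul_assoc]
        _ = _ := by rw [hconj, hconj₂]

end IntegerSymplecticInvolution

end Literature.LinearAlgebra.Matrix
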